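import Literature.AlgebraicGeometry.VanGeemen1994.WeilDiscriminantClass
import Literature.NumberTheory.ComplexMultiplication.CMTorusPolarizationType
import Literature.NumberTheory.ComplexMultiplication.CMTypeRiemannForm
import Summits.HodgeConjecture.HodgeConjecture.Theorems.Ring2WeilCoverageTraceGramDeterminant
import Summits.HodgeConjecture.HodgeConjecture.Theorems.Ring2WeilCoverageNormCriteria
import HarnessLib

/-!
# Weil-type family coverage — THE COMPONENT RULE IN THE KERNEL: van Geemen's Gram matrix `Ψ = a + b√−d` of the
# Riemann form `E_ζ′ = Tr_{K/ℚ}(ζ′ x ȳ)` of a CM point with `ℚ(√−d) = ℚ(s) ⊂ K` structure, read in a REAL frame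
# `ω ⊂ K⁺`: `b = 0`, `a = −2·(Tr_{K⁺/ℚ}(γ₀ ωᵢ ωⱼ))`, `γ₀ = ζ′s`, `det a = (−2)^g N_{K⁺/ℚ}(γ₀) disc(ω)`; the class
# multiplies by `N_{K⁺/ℚ}(β)` under `ζ′ ↦ βζ′` and is an invariant of the TYPE `(K; Φ; 𝔣₀)` on `𝔪` under THEOREM L (i)

research route conditional on HC_CM; not a corollary; Q11.4-sentence-2 already refuted in dim ≥ 3.

Ring 2, WEIL-TYPE FAMILY-COVERAGE CENSUS (`HOME/WEIL-FAMILY-COVERAGE.md` `## b01`, blocks b01.41 (C) «COMPONENTS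
(S-pencil, exact)», b01.46 (C2)/(E) «NOT CLAIMED: the component classes in the kernel», owner ring2-b01), part 82 of
the `Ring2WeilCoverage*` series.  SETTING: `K` a CM field (`ρ = complexConj K`, `K⁺ = maximalRealSubfield K`),
`s ∈ K` skew (the census's `√−d`; `ι(s)` is van Geemen's `φ`, `φ² = −d`), `ζ′ ∈ K` skew (Shimura's parameter: the
Riemann form of `X_ζ′` on `ℂ^Φ/D(𝔪)` is `E_ζ′(v(α), v(β)) = Tr_{K/ℚ}(ζ′αβ^ρ)`, Literature
`CMTypeLattice.riemannForm_cmEmbedding`), a frame `x : Fin m → K`; van Geemen's `H(x, y) = E(x, s y) + √−d E(x, y)`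
has Gram matrix `Ψ = a + b√−d`, `aᵢⱼ = E(xᵢ, s xⱼ)`, `bᵢⱼ = E(xᵢ, xⱼ)` (Literature `VanGeemen1994.weilGramMatrix`;
[vG94 Lemma 5.2 (2)–(3)]: the class of `det Ψ` in `ℚˣ/Nm(K_dˣ)` is the isogeny invariant `det H` = the census
COMPONENT).  The rational matrices `a, b` are carried with hypotheses `ha : aᵢⱼ = Tr(ζ′xᵢ(s xⱼ)^ρ)`,
`hb : bᵢⱼ = Tr(ζ′xᵢxⱼ^ρ)` (§5: these ARE `E_ζ′(v xᵢ, v(s xⱼ))`, `E_ζ′(v xᵢ, v xⱼ)` on `ℂ^Φ`, every `Φ`).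

* §1 real frames (`xᵢ^ρ = xᵢ`): **`hb_eq_zero` (`b = 0`), `ha_eq` (`aᵢⱼ = −Tr(ζ′s·xᵢxⱼ)`)**, `a` symmetric,
  **`weilGramMatrix_realFrame` (`Ψ = a`), `det_weilGramMatrix_realFrame` (`det Ψ = det a`)**.
* §2 through `K⁺` (`xᵢ = ωᵢ ∈ K⁺`, `γ₀ = ζ′s ∈ K⁺`): `trace_coe_realSubfield` (`Tr_{K/ℚ} = 2 Tr_{K⁺/ℚ}` on `K⁺`),
  **`realPart_eq_smul`: `a = (−2)·(Tr_{K⁺/ℚ}(γ₀ωᵢωⱼ))`**, and for a `ℚ`-BASIS `ω` of `K⁺` **`det_realPart_eq`: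
  `det a = (−2)^g N_{K⁺/ℚ}(γ₀) disc(ω)`** (part 81), `det a ≠ 0`; `linearIndependent_realFrame`: `{ωᵢ, sωᵢ}` is
  `ℚ`-free (so `{ωᵢ}` is a `K_d`-basis of `K`, as [vG94 5.2 (3)] requires).
* §3 **THE COMPONENT RULE `det_realPart_mul`: `det a(β₀ζ′) = N_{K⁺/ℚ}(β₀)·det a(ζ′)`** (`β₀ ∈ K⁺`; type
  `𝔣₀ ↦ (β₀)𝔣₀`) and **`det_realPart_units_mul`**: a real unit of norm `+1` changes nothing (THEOREM L (i), parts
  44/67/71–74, says exactly when every real unit has norm `+1`).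
* §4 TYPES: `exists_units_eq_mul_of_isOfType` (two skew parameters of the same type on the same `𝔪` differ by a unit
  of `𝓞 K⁺`, [Sh98 §14.3 Prop. 5]) and **`det_realPart_eq_of_isOfType`: under L (i), `det a` depends only on
  `(𝔪, 𝔣₀, s, ω)`** — every `Φ`-positive `ζ′` of the type, for every `Φ`, gives the same number.
* §5 the dictionary to `E_ζ′` on `ℂ^Φ`; §6 for even `g` **`mk0_det_realPart_eq`: `[det a] = [N_{K⁺/ℚ}(γ₀)·disc(ω)]`**.

HONEST FRAMING: statements about traces, norms, discriminants in a CM field and the rational matrices `(a, b)`; by §5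
and [vG94 Lemma 5.2] these are the Gram data of `(ℂ^Φ/D(𝔪), E_ζ′, ι(s))` when `ζ′` is `Φ`-positive, but no statement
about Hodge classes, `W_K`, general members of a component or HC is made; the signature plays no role in the algebra.
`HC_CM` is used nowhere.  No `def`, no named fact, no `sorry`.  The per-level NUMBERS are parts 83+.

References: [cite: vanGeemen1994HodgeAV, Lemma 5.2 (2)–(3), 5.4 and (5.4.1)]; [cite: Shimura1998, §6.2 Thm. 4 and
§14.3 Prop. 4–5, pp. 44–45, 103–104]; census b01.41 (C), b01.46 (C2)/(E) (seat-derived).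
-/

noncomputable section

open Polynomial Module NumberField
open scoped nonZeroDivisors

namespace Summit.HodgeConjecture.Ring2WeilCoverage.WeilGramCMPoint

open Literature.AlgebraicGeometry.VanGeemen1994 (weilField weilSqrt weilGramMatrix weilNormResidueGroup)
open Literature.AlgebraicGeometry.Motives (CMType normUnitsSubgroup)
open Literature.NumberTheory.ComplexMultiplication
open Summit.HodgeConjecture.Ring2WeilCoverage.TraceGramDeterminant (det_of_trace_mul_mul)
open Summit.HodgeConjecture.HodgeConjecture.Ring2.WeilCoverage (sq_mem_normUnitsSubgroup)

variable {K : Type} [Field K] [NumberField K] [IsCMField K]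

/-! ### §1 Real frames: `b = 0`, `a = −Tr(ζ′s·xᵢxⱼ)` -/

/-- A skew element (`y^ρ = −y`) has trace `0`.
research route conditional on HC_CM; not a corollary; Q11.4-sentence-2 already refuted in dim ≥ 3. [folklore] -/
theorem trace_eq_zero_of_skew {y : K} (hy : IsCMField.complexConj K y = -y) : Algebra.trace ℚ K y = 0 := by
  -- `Tr ∘ ρ = Tr` (`ρ` is a `ℚ`-algebra automorphism; cf. Literature `SiegelCMPoint.trace_complexConj`)
  have h : Algebra.trace ℚ K (IsCMField.complexConj K y) = Algebra.trace ℚ K y :=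
    Algebra.trace_eq_of_algEquiv ((IsCMField.complexConj K).restrictScalars ℚ) y
  rw [hy, map_neg] at h
  linarith

section RealFrame

variable {m : ℕ} {ζ' s : K} {x : Fin m → K}

/-- **`b = 0` on a real frame**: `Tr(ζ′ xᵢ xⱼ^ρ) = 0` when `ζ′` is skew and the `xᵢ` are real (the element is skew).
research route conditional on HC_CM; not a corollary; Q11.4-sentence-2 already refuted in dim ≥ 3. [cite: vanGeemen1994HodgeAV, Lemma 5.2 (2)] -/
theorem trace_imPart_eq_zero (hζ' : IsCMField.complexConj K ζ' = -ζ')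
    (hx : ∀ i, IsCMField.complexConj K (x i) = x i) (i j : Fin m) :
    Algebra.trace ℚ K (ζ' * x i * IsCMField.complexConj K (x j)) = 0 := by
  apply trace_eq_zero_of_skew
  rw [map_mul, map_mul, hζ', hx i, IsCMField.complexConj_apply_apply, hx j]
  ring

/-- **`aᵢⱼ = −Tr(ζ′s·xᵢxⱼ)` on a real frame** (`s` skew): `E(xᵢ, s xⱼ) = Tr(ζ′ xᵢ (s xⱼ)^ρ) = −Tr(ζ′ s xᵢ xⱼ)`.
research route conditional on HC_CM; not a corollary; Q11.4-sentence-2 already refuted in dim ≥ 3. [cite: vanGeemen1994HodgeAV, Lemma 5.2 (2)] -/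
theorem trace_realPart_eq (hs : IsCMField.complexConj K s = -s)
    (hx : ∀ i, IsCMField.complexConj K (x i) = x i) (i j : Fin m) :
    Algebra.trace ℚ K (ζ' * x i * IsCMField.complexConj K (s * x j)) =
      - Algebra.trace ℚ K (ζ' * s * (x i * x j)) := by
  rw [map_mul (IsCMField.complexConj K) s (x j), hs, hx j, ← map_neg]
  congr 1
  ring

variable {a b : Matrix (Fin m) (Fin m) ℚ}

/-- **`b = 0`** for the Gram data `(a, b)` of `(E_ζ′, s)` in a real frame.
research route conditional on HC_CM; not a corollary; Q11.4-sentence-2 already refuted in dim ≥ 3. [cite: vanGeemen1994HodgeAV, Lemma 5.2 (2)–(3)] -/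
theorem hb_eq_zero (hζ' : IsCMField.complexConj K ζ' = -ζ') (hx : ∀ i, IsCMField.complexConj K (x i) = x i)
    (hb : ∀ i j, b i j = Algebra.trace ℚ K (ζ' * x i * IsCMField.complexConj K (x j))) : b = 0 := by
  ext i j
  rw [hb, trace_imPart_eq_zero hζ' hx, Matrix.zero_apply]

/-- **`a = (−Tr(ζ′s·xᵢxⱼ))ᵢⱼ`** for the Gram data of `(E_ζ′, s)` in a real frame.
research route conditional on HC_CM; not a corollary; Q11.4-sentence-2 already refuted in dim ≥ 3. [cite: vanGeemen1994HodgeAV, Lemma 5.2 (2)–(3)] -/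
theorem ha_eq (hs : IsCMField.complexConj K s = -s) (hx : ∀ i, IsCMField.complexConj K (x i) = x i)
    (ha : ∀ i j, a i j = Algebra.trace ℚ K (ζ' * x i * IsCMField.complexConj K (s * x j))) :
    a = Matrix.of fun i j => - Algebra.trace ℚ K (ζ' * s * (x i * x j)) := by
  ext i j
  rw [ha, trace_realPart_eq hs hx, Matrix.of_apply]

/-- **`Ψ = a` in a real frame**: van Geemen's Gram matrix `weilGramMatrix d a b = a + b√−d` is the rational matrix `a`.
research route conditional on HC_CM; not a corollary; Q11.4-sentence-2 already refuted in dim ≥ 3. [cite: vanGeemen1994HodgeAV, Lemma 5.2 (2)–(3)] -/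
theorem weilGramMatrix_realFrame (d : ℕ) (hζ' : IsCMField.complexConj K ζ' = -ζ')
    (hx : ∀ i, IsCMField.complexConj K (x i) = x i)
    (hb : ∀ i j, b i j = Algebra.trace ℚ K (ζ' * x i * IsCMField.complexConj K (x j))) :
    weilGramMatrix d a b = (algebraMap ℚ (weilField d)).mapMatrix a := by
  rw [hb_eq_zero hζ' hx hb]
  ext i j
  simp [weilGramMatrix]

/-- **`det Ψ = det a`** (in `K_d`, as the image of the rational number `det a`).
research route conditional on HC_CM; not a corollary; Q11.4-sentence-2 already refuted in dim ≥ 3. [cite: vanGeemen1994HodgeAV, Lemma 5.2 (3)] -/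
theorem det_weilGramMatrix_realFrame (d : ℕ) (hζ' : IsCMField.complexConj K ζ' = -ζ')
    (hx : ∀ i, IsCMField.complexConj K (x i) = x i)
    (hb : ∀ i j, b i j = Algebra.trace ℚ K (ζ' * x i * IsCMField.complexConj K (x j))) :
    (weilGramMatrix d a b).det = algebraMap ℚ (weilField d) a.det := by
  rw [weilGramMatrix_realFrame d hζ' hx hb, ← RingHom.map_det]

end RealFrame

/-! ### §2 Through the maximal real subfield: `a = −2·(Tr_{K⁺/ℚ}(γ₀ ωᵢ ωⱼ))`, `det a = (−2)^g N(γ₀) disc(ω)` -/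

/-- A product of two skew elements is real: `ζ′s = γ₀ ∈ K⁺`.
research route conditional on HC_CM; not a corollary; Q11.4-sentence-2 already refuted in dim ≥ 3. [folklore] -/
theorem exists_real_eq_mul_of_skew {ζ' s : K} (hζ' : IsCMField.complexConj K ζ' = -ζ')
    (hs : IsCMField.complexConj K s = -s) :
    ∃ γ₀ : maximalRealSubfield K, (γ₀ : K) = ζ' * s := by
  refine ⟨⟨ζ' * s, ?_⟩, rfl⟩
  rw [← IsCMField.complexConj_eq_self_iff, map_mul, hζ', hs, neg_mul_neg]

/-- `Tr_{K/ℚ}(y) = 2·Tr_{K⁺/ℚ}(y)` for `y ∈ K⁺` (`[K : K⁺] = 2`).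
research route conditional on HC_CM; not a corollary; Q11.4-sentence-2 already refuted in dim ≥ 3. [folklore] -/
theorem trace_coe_realSubfield (y : maximalRealSubfield K) :
    Algebra.trace ℚ K (y : K) = 2 * Algebra.trace ℚ (maximalRealSubfield K) y := by
  have hfin : Module.Finite (maximalRealSubfield K) K :=
    Module.finite_of_finrank_eq_succ (Algebra.IsQuadraticExtension.finrank_eq_two (maximalRealSubfield K) K)
  rw [← Algebra.trace_trace (S := maximalRealSubfield K),
    show ((y : K)) = algebraMap (maximalRealSubfield K) K y from rfl, Algebra.trace_algebraMap,
    Algebra.IsQuadraticExtension.finrank_eq_two, map_nsmul, nsmul_eq_mul, Nat.cast_ofNat]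

section RealSubfield

variable {m : ℕ} {ζ' s : K} {x : Fin m → K} {ω : Fin m → maximalRealSubfield K} {γ₀ : maximalRealSubfield K}
  {a : Matrix (Fin m) (Fin m) ℚ}

/-- A frame drawn from `K⁺` is real.
research route conditional on HC_CM; not a corollary; Q11.4-sentence-2 already refuted in dim ≥ 3. [folklore] -/
theorem complexConj_frame (hx : ∀ i, x i = (ω i : K)) (i : Fin m) : IsCMField.complexConj K (x i) = x i := by
  rw [hx i, IsCMField.complexConj_apply_eq_self]

/-- **`a = (−2)·(Tr_{K⁺/ℚ}(γ₀ ωᵢ ωⱼ))ᵢⱼ`**: the real part of van Geemen's Gram matrix in the real frame `ω` is `−2`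
times the `γ₀`-twisted trace form of `K⁺/ℚ`, `γ₀ = ζ′s`.
research route conditional on HC_CM; not a corollary; Q11.4-sentence-2 already refuted in dim ≥ 3. [cite: vanGeemen1994HodgeAV, Lemma 5.2 (2)–(3)] -/
theorem realPart_eq_smul (hs : IsCMField.complexConj K s = -s) (hx : ∀ i, x i = (ω i : K))
    (hγ : (γ₀ : K) = ζ' * s)
    (ha : ∀ i j, a i j = Algebra.trace ℚ K (ζ' * x i * IsCMField.complexConj K (s * x j))) :
    a = (-2 : ℚ) • Matrix.of fun i j => Algebra.trace ℚ (maximalRealSubfield K) (γ₀ * (ω i * ω j)) := by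
  rw [ha_eq hs (complexConj_frame hx) ha]
  ext i j
  simp only [Matrix.smul_apply, Matrix.of_apply, smul_eq_mul]
  rw [← hγ, hx i, hx j, show (γ₀ : K) * ((ω i : K) * (ω j : K)) = ((γ₀ * (ω i * ω j) : maximalRealSubfield K) : K)
    by push_cast; ring, trace_coe_realSubfield]
  ring

/-- **`det a = (−2)^g · N_{K⁺/ℚ}(γ₀) · disc_{K⁺/ℚ}(ω)`** for a `ℚ`-basis `ω` of `K⁺` (`g = [K⁺:ℚ]`), `γ₀ = ζ′s`.
research route conditional on HC_CM; not a corollary; Q11.4-sentence-2 already refuted in dim ≥ 3. [cite: vanGeemen1994HodgeAV, Lemma 5.2 (3)] -/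
theorem det_realPart_eq (ωb : Basis (Fin m) ℚ (maximalRealSubfield K)) (hs : IsCMField.complexConj K s = -s)
    (hx : ∀ i, x i = (ωb i : K)) (hγ : (γ₀ : K) = ζ' * s)
    (ha : ∀ i j, a i j = Algebra.trace ℚ K (ζ' * x i * IsCMField.complexConj K (s * x j))) :
    a.det = (-2 : ℚ) ^ m * Algebra.norm ℚ γ₀ * Algebra.discr ℚ ωb := by
  rw [realPart_eq_smul (ω := ωb) hs hx hγ ha, Matrix.det_smul, Fintype.card_fin, det_of_trace_mul_mul, mul_assoc]

/-- `det a ≠ 0` when `γ₀ ≠ 0` (non-degeneracy, [vG94 5.2 (2)]).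
research route conditional on HC_CM; not a corollary; Q11.4-sentence-2 already refuted in dim ≥ 3. [cite: vanGeemen1994HodgeAV, Lemma 5.2 (2)] -/
theorem det_realPart_ne_zero (ωb : Basis (Fin m) ℚ (maximalRealSubfield K)) (hs : IsCMField.complexConj K s = -s)
    (hx : ∀ i, x i = (ωb i : K)) (hγ : (γ₀ : K) = ζ' * s) (hγ0 : γ₀ ≠ 0)
    (ha : ∀ i j, a i j = Algebra.trace ℚ K (ζ' * x i * IsCMField.complexConj K (s * x j))) :
    a.det ≠ 0 := by
  rw [det_realPart_eq ωb hs hx hγ ha]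
  exact mul_ne_zero (mul_ne_zero (pow_ne_zero _ (by norm_num)) (Algebra.norm_ne_zero_iff.mpr hγ0))
    (Algebra.discr_not_zero_of_basis ℚ ωb)

/-- **The real frame is a `K_d`-frame**: `{ωᵢ} ∪ {s·ωᵢ}` is `ℚ`-linearly independent in `K` for a `ℚ`-linearly
independent real family `ω` and a non-zero skew `s` (so for a `ℚ`-basis `ω` of `K⁺`, `2g = [K:ℚ]` vectors: a
`ℚ`-basis of `K`, i.e. `{ωᵢ}` is a basis of `K` over `K_d = ℚ(s)`).
research route conditional on HC_CM; not a corollary; Q11.4-sentence-2 already refuted in dim ≥ 3. [cite: vanGeemen1994HodgeAV, Lemma 5.2 (3)] -/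
theorem linearIndependent_realFrame (hω : LinearIndependent ℚ ω) (hs : IsCMField.complexConj K s = -s)
    (hs0 : s ≠ 0) :
    LinearIndependent ℚ (fun p : Fin m ⊕ Fin m => Sum.elim (fun i => (ω i : K)) (fun i => s * (ω i : K)) p) := by
  classical
  rw [Fintype.linearIndependent_iff]
  intro c hc
  rw [Fintype.sum_sum_type] at hc
  simp only [Sum.elim_inl, Sum.elim_inr] at hc
  -- real and imaginary parts: `P + s Q = 0` with `P, Q ∈ K⁺`
  set P : maximalRealSubfield K := ∑ i, c (Sum.inl i) • ω i with hP
  set Q : maximalRealSubfield K := ∑ i, c (Sum.inr i) • ω i with hQ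
  have hPK : (P : K) = ∑ i, c (Sum.inl i) • (ω i : K) := by rw [hP]; push_cast; rfl
  have hQK : (Q : K) = ∑ i, c (Sum.inr i) • (ω i : K) := by rw [hQ]; push_cast; rfl
  have hsum : (P : K) + s * (Q : K) = 0 := by
    rw [hPK, hQK, Finset.mul_sum, ← hc]
    congr 1
    exact Finset.sum_congr rfl fun i _ => by rw [mul_smul_comm]
  -- apply `ρ`: `P − sQ = 0`
  have hconj : (P : K) - s * (Q : K) = 0 := by
    have h := congrArg (IsCMField.complexConj K) hsum
    rw [map_add, map_mul, hs, IsCMField.complexConj_apply_eq_self, IsCMField.complexConj_apply_eq_self,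
      map_zero] at h
    linear_combination h
  have hP0 : (P : K) = 0 := by linear_combination (hsum + hconj) / 2
  have hQ0 : (Q : K) = 0 := by
    have h2 : s * (Q : K) = 0 := by linear_combination (hsum - hconj) / 2
    exact (mul_eq_zero.mp h2).resolve_left hs0
  have hP0' : P = 0 := by exact_mod_cast hP0
  have hQ0' : Q = 0 := by exact_mod_cast hQ0
  have hli := Fintype.linearIndependent_iff.mp hω
  intro p
  rcases p with i | i
  · exact hli (fun i => c (Sum.inl i)) (by rw [← hP]; exact hP0') i
  · exact hli (fun i => c (Sum.inr i)) (by rw [← hQ]; exact hQ0') i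

end RealSubfield

/-! ### §3 The component rule: `ζ′ ↦ β₀ζ′` multiplies `det a` by `N_{K⁺/ℚ}(β₀)`; real units of norm `+1` do nothing -/

section ComponentRule

variable {m : ℕ} {ζ' s : K} {x : Fin m → K} {γ₀ β₀ : maximalRealSubfield K} {a a' : Matrix (Fin m) (Fin m) ℚ}

/-- **THE COMPONENT RULE.**  If `(a, 0)` is the Gram datum of `(E_ζ′, s)` and `(a′, 0)` that of `(E_{β₀ζ′}, s)` in the
same real `ℚ`-basis frame `ω` of `K⁺` (`β₀ ∈ K⁺`; e.g. type `𝔣₀ ↦ (β₀)𝔣₀`), then `det a′ = N_{K⁺/ℚ}(β₀) · det a`.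
research route conditional on HC_CM; not a corollary; Q11.4-sentence-2 already refuted in dim ≥ 3. [cite: vanGeemen1994HodgeAV, Lemma 5.2 (3)] -/
theorem det_realPart_mul (ωb : Basis (Fin m) ℚ (maximalRealSubfield K)) (hs : IsCMField.complexConj K s = -s)
    (hx : ∀ i, x i = (ωb i : K)) (hγ : (γ₀ : K) = ζ' * s)
    (ha : ∀ i j, a i j = Algebra.trace ℚ K (ζ' * x i * IsCMField.complexConj K (s * x j)))
    (ha' : ∀ i j, a' i j = Algebra.trace ℚ K ((β₀ : K) * ζ' * x i * IsCMField.complexConj K (s * x j))) :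
    a'.det = Algebra.norm ℚ β₀ * a.det := by
  have hγ' : ((β₀ * γ₀ : maximalRealSubfield K) : K) = (β₀ : K) * ζ' * s := by push_cast; rw [hγ, mul_assoc]
  rw [det_realPart_eq ωb hs hx hγ ha, det_realPart_eq (ζ' := (β₀ : K) * ζ') ωb hs hx hγ' ha', map_mul]
  ring

omit [IsCMField K] in
/-- A unit of `𝓞 K⁺` has norm `±1`; with `N > 0` (THEOREM L (i)) its norm is `1`.
research route conditional on HC_CM; not a corollary; Q11.4-sentence-2 already refuted in dim ≥ 3. [folklore] -/
theorem norm_realUnits_eq_one (u : (𝓞 (maximalRealSubfield K))ˣ)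
    (hL : 0 < Algebra.norm ℚ (((u : 𝓞 (maximalRealSubfield K)) : maximalRealSubfield K))) :
    Algebra.norm ℚ (((u : 𝓞 (maximalRealSubfield K)) : maximalRealSubfield K)) = 1 := by
  have h := NumberField.Units.norm (maximalRealSubfield K) u
  rw [abs_eq_self.mpr hL.le] at h
  exact h

/-- **UNIT INVARIANCE under THEOREM L (i)**: replacing `ζ′` by `uζ′` for a unit `u` of `𝓞 K⁺` of norm `+1` does not
change `det a`.
research route conditional on HC_CM; not a corollary; Q11.4-sentence-2 already refuted in dim ≥ 3. [cite: vanGeemen1994HodgeAV, Lemma 5.2 (3)] -/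
theorem det_realPart_units_mul (ωb : Basis (Fin m) ℚ (maximalRealSubfield K))
    (hs : IsCMField.complexConj K s = -s) (hx : ∀ i, x i = (ωb i : K)) (hγ : (γ₀ : K) = ζ' * s)
    (u : (𝓞 (maximalRealSubfield K))ˣ)
    (hL : 0 < Algebra.norm ℚ (((u : 𝓞 (maximalRealSubfield K)) : maximalRealSubfield K)))
    (ha : ∀ i j, a i j = Algebra.trace ℚ K (ζ' * x i * IsCMField.complexConj K (s * x j)))
    (ha' : ∀ i j, a' i j = Algebra.trace ℚ K
      (((((u : 𝓞 (maximalRealSubfield K)) : maximalRealSubfield K)) : K) * ζ' * x i *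
        IsCMField.complexConj K (s * x j))) :
    a'.det = a.det := by
  rw [det_realPart_mul ωb hs hx hγ ha ha', norm_realUnits_eq_one u hL, one_mul]

end ComponentRule

/-! ### §4 Types: two parameters of the same type `(K; Φ; 𝔣₀)` on `𝔪` differ by a real unit -/

section Types

variable {𝔪 : (FractionalIdeal (𝓞 K)⁰ K)ˣ} {𝔣₀ : Ideal (𝓞 (maximalRealSubfield K))} {ζ' ζ'' : K}

/-- **Same type ⟹ `ζ″ = u·ζ′` with `u` a unit of `𝓞 K⁺`** ([Sh98 §14.3 Prop. 5]: `ζ′⁻¹ζ″` is a unit; it is real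
because both parameters are skew).
research route conditional on HC_CM; not a corollary; Q11.4-sentence-2 already refuted in dim ≥ 3. [cite: Shimura1998, §14.3 Prop. 5, p. 104] -/
theorem exists_units_eq_mul_of_isOfType (hζ' : IsCMField.complexConj K ζ' = -ζ') (hζ'0 : ζ' ≠ 0)
    (hζ'' : IsCMField.complexConj K ζ'' = -ζ'') (h' : CMTypeLattice.IsOfType 𝔪 ζ' 𝔣₀)
    (h'' : CMTypeLattice.IsOfType 𝔪 ζ'' 𝔣₀) :
    ∃ u : (𝓞 (maximalRealSubfield K))ˣ,
      ζ'' = ((((u : 𝓞 (maximalRealSubfield K)) : maximalRealSubfield K)) : K) * ζ' := by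
  obtain ⟨ε, hε⟩ := (CMTypeLattice.isOfType_iff_exists_units_eq_mul (𝔪 := 𝔪) h').mp h''
  have hεreal : IsCMField.complexConj K ((ε : 𝓞 K) : K) = ((ε : 𝓞 K) : K) := by
    have h1 : ((ε : 𝓞 K) : K) = ζ'' * ζ'⁻¹ := by rw [hε, mul_inv_cancel_right₀ hζ'0]
    rw [h1, map_mul, map_inv₀, hζ', hζ'', inv_neg, neg_mul_neg]
  obtain ⟨v, hv⟩ := (IsCMField.Units.complexConj_eq_self_iff K ε).mp hεreal
  refine ⟨v, ?_⟩
  have h1 : (algebraMap (𝓞 K) K) (ε : 𝓞 K) = ((ε : 𝓞 K) : K) := rfl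
  have h2 : (algebraMap (𝓞 (maximalRealSubfield K)) K) (v : 𝓞 (maximalRealSubfield K)) =
      ((((v : 𝓞 (maximalRealSubfield K)) : maximalRealSubfield K)) : K) := by
    rw [IsScalarTower.algebraMap_apply (𝓞 (maximalRealSubfield K)) (maximalRealSubfield K) K]
    rfl
  rw [hε, ← h1, ← hv, h2]

variable {m : ℕ} {s : K} {x : Fin m → K} {γ₀ : maximalRealSubfield K} {a a' : Matrix (Fin m) (Fin m) ℚ}

/-- **`det a` IS AN INVARIANT OF THE TYPE under THEOREM L (i)**: if every unit of `𝓞 K⁺` has positive norm, two skew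
parameters `ζ′, ζ″` of the same type `(K; Φ; 𝔣₀)` on the same lattice `𝔪` have the same Gram determinant in any
real basis frame — whatever CM type `Φ` makes them positive.
research route conditional on HC_CM; not a corollary; Q11.4-sentence-2 already refuted in dim ≥ 3. [cite: vanGeemen1994HodgeAV, Lemma 5.2 (3)] [cite: Shimura1998, §14.3 Prop. 5, p. 104] -/
theorem det_realPart_eq_of_isOfType (ωb : Basis (Fin m) ℚ (maximalRealSubfield K))
    (hs : IsCMField.complexConj K s = -s) (hx : ∀ i, x i = (ωb i : K))
    (hL : ∀ u : (𝓞 (maximalRealSubfield K))ˣ,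
      0 < Algebra.norm ℚ (((u : 𝓞 (maximalRealSubfield K)) : maximalRealSubfield K)))
    (hζ' : IsCMField.complexConj K ζ' = -ζ') (hζ'0 : ζ' ≠ 0) (hζ'' : IsCMField.complexConj K ζ'' = -ζ'')
    (h' : CMTypeLattice.IsOfType 𝔪 ζ' 𝔣₀) (h'' : CMTypeLattice.IsOfType 𝔪 ζ'' 𝔣₀)
    (ha : ∀ i j, a i j = Algebra.trace ℚ K (ζ' * x i * IsCMField.complexConj K (s * x j)))
    (ha' : ∀ i j, a' i j = Algebra.trace ℚ K (ζ'' * x i * IsCMField.complexConj K (s * x j))) :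
    a'.det = a.det := by
  obtain ⟨γ₀, hγ⟩ := exists_real_eq_mul_of_skew hζ' hs
  obtain ⟨u, hu⟩ := exists_units_eq_mul_of_isOfType hζ' hζ'0 hζ'' h' h''
  refine det_realPart_units_mul ωb hs hx hγ u (hL u) ha fun i j => ?_
  rw [ha', hu]

end Types

/-! ### §5 The dictionary to Shimura's Riemann form `E_ζ′` on `ℂ^Φ` -/

section Dictionary

variable {m : ℕ} {ζ' s : K} {x : Fin m → K} {a b : Matrix (Fin m) (Fin m) ℚ}

/-- `aᵢⱼ = E_ζ′(v(xᵢ), v(s xⱼ))` on `ℂ^Φ`, for every CM type `Φ` ([Sh98 §6.2]: `E(v(α), v(β)) = Tr(ζ′αβ^ρ)`).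
research route conditional on HC_CM; not a corollary; Q11.4-sentence-2 already refuted in dim ≥ 3. [cite: Shimura1998, §6.2 Thm. 4, pp. 44–45] -/
theorem realPart_eq_riemannForm (Φ : CMType K) (hζ' : IsCMField.complexConj K ζ' = -ζ')
    (ha : ∀ i j, a i j = Algebra.trace ℚ K (ζ' * x i * IsCMField.complexConj K (s * x j))) (i j : Fin m) :
    algebraMap ℚ ℝ (a i j) =
      CMTypeLattice.riemannForm Φ ζ' (CMTypeLattice.cmEmbedding Φ (x i)) (CMTypeLattice.cmEmbedding Φ (s * x j)) := by
  rw [ha, CMTypeLattice.riemannForm_cmEmbedding Φ hζ']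

/-- `bᵢⱼ = E_ζ′(v(xᵢ), v(xⱼ))` on `ℂ^Φ`, for every CM type `Φ`.
research route conditional on HC_CM; not a corollary; Q11.4-sentence-2 already refuted in dim ≥ 3. [cite: Shimura1998, §6.2 Thm. 4, pp. 44–45] -/
theorem imPart_eq_riemannForm (Φ : CMType K) (hζ' : IsCMField.complexConj K ζ' = -ζ')
    (hb : ∀ i j, b i j = Algebra.trace ℚ K (ζ' * x i * IsCMField.complexConj K (x j))) (i j : Fin m) :
    algebraMap ℚ ℝ (b i j) =
      CMTypeLattice.riemannForm Φ ζ' (CMTypeLattice.cmEmbedding Φ (x i)) (CMTypeLattice.cmEmbedding Φ (x j)) := by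
  rw [hb, CMTypeLattice.riemannForm_cmEmbedding Φ hζ']

end Dictionary

/-! ### §6 Classes in `ℚˣ/Nm(K_dˣ)` -/

section Classes

variable {m : ℕ} {ζ' s : K} {x : Fin m → K} {γ₀ : maximalRealSubfield K} {a : Matrix (Fin m) (Fin m) ℚ}

/-- **For EVEN `g`: `[det a] = [N_{K⁺/ℚ}(γ₀) · disc(ω)]` in `ℚˣ/Nm(K_dˣ)`** (`(−2)^g = (2^{g/2})²` is a norm).
research route conditional on HC_CM; not a corollary; Q11.4-sentence-2 already refuted in dim ≥ 3. [cite: vanGeemen1994HodgeAV, Lemma 5.2 (3)] -/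
theorem mk0_det_realPart_eq (d : ℕ) (ωb : Basis (Fin m) ℚ (maximalRealSubfield K)) (hm : Even m)
    (hs : IsCMField.complexConj K s = -s) (hx : ∀ i, x i = (ωb i : K)) (hγ : (γ₀ : K) = ζ' * s) (hγ0 : γ₀ ≠ 0)
    (ha : ∀ i j, a i j = Algebra.trace ℚ K (ζ' * x i * IsCMField.complexConj K (s * x j))) :
    (QuotientGroup.mk (Units.mk0 a.det (det_realPart_ne_zero ωb hs hx hγ hγ0 ha)) : weilNormResidueGroup d) =
      QuotientGroup.mk (Units.mk0 (Algebra.norm ℚ γ₀ * Algebra.discr ℚ ωb)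
        (mul_ne_zero (Algebra.norm_ne_zero_iff.mpr hγ0) (Algebra.discr_not_zero_of_basis ℚ ωb))) := by
  obtain ⟨k, hk⟩ := hm
  have hsq0 : ((-2 : ℚ)) ^ m = ((-2 : ℚ) ^ 2) ^ k := by rw [← pow_mul, hk, two_mul]
  have hsq : ((-2 : ℚ)) ^ m = ((2 : ℚ) ^ k) ^ 2 := by
    rw [hsq0, show ((-2 : ℚ)) ^ 2 = (2 : ℚ) ^ 2 by norm_num, ← pow_mul, ← pow_mul, mul_comm]
  have hval : a.det = (-2 : ℚ) ^ m * (Algebra.norm ℚ γ₀ * Algebra.discr ℚ ωb) := by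
    rw [det_realPart_eq ωb hs hx hγ ha, mul_assoc]
  have h3 : Algebra.norm ℚ γ₀ * Algebra.discr ℚ ωb ≠ 0 :=
    mul_ne_zero (Algebra.norm_ne_zero_iff.mpr hγ0) (Algebra.discr_not_zero_of_basis ℚ ωb)
  rw [QuotientGroup.eq]
  have e : (Units.mk0 a.det (det_realPart_ne_zero ωb hs hx hγ hγ0 ha))⁻¹ *
      Units.mk0 (Algebra.norm ℚ γ₀ * Algebra.discr ℚ ωb) h3 =
      Units.mk0 ((((2 : ℚ) ^ k)⁻¹) ^ 2) (pow_ne_zero _ (inv_ne_zero (pow_ne_zero _ (by norm_num)))) := by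
    refine Units.ext ?_
    simp only [Units.val_mul, Units.val_inv_eq_inv_val, Units.val_mk0]
    rw [hval, hsq, mul_inv, inv_mul_cancel_right₀ h3, inv_pow]
  rw [e]
  exact sq_mem_normUnitsSubgroup (inv_ne_zero (pow_ne_zero _ (by norm_num)))

end Classes

end Summit.HodgeConjecture.Ring2WeilCoverage.WeilGramCMPoint

end
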